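import Summits.ABC.IUTFork.Conditional.AbcOfSGenuineMWindow
import Summits.ABC.ABC.Theorems.IUTThetaPilotThetaPartIIDegLe
import HarnessLib

/-!
# Branch C, M line — the DEGREE-ONE CUT of the window certificate `abc_of_SH_v11M_window` (p445989): Vojta's height inequality (printed `1+ε`)
# for the RATIONAL points of the `λ`-line on every compactly bounded `K_V ∋ 2`, from S_H ON THE UNDECIDED WINDOW + the NUMBER-level Corollary
# ON THE M-DEPTH LOCUS — explicit 2 = S_H(window) · NUM(deep); NO cone binder, NO Θ-side binder

C scoreboard (INTAKE fold, abc-iut-C-cert-3 gen 2). PROOF-ONLY (no `def`, no new `Prop`; nothing re-typed). CONTEXT: abc-iut-w6-d115's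
degree-one cuts `vojta_degOne_of_SH_v10M` / `vojta_degOne_of_SH_v6K_of_forall` (p443731) take the BLANKET S_H hypothesis at the admissible
Θ-data of RATIONAL points; that hypothesis is now KERNEL-FALSE even restricted to rational points — the HEX witness `λ_k = 1/2 + 2/7^k` IS a
rational admissible point (abc-iut-C-cert-1 `not_hSH_v6K` p443604, abc-iut-w5-d166 `not_hSH_v10M` p446230) — so those cuts are COMPOSITION
RECORDS like their parents. The hex-free degree-one statement of record is abc-iut-s2-p10's `vojta_degOne_of_cor312Statement_genuineM`
(p444732: explicit 1 = the typed Cor. 3.12 `Statement`). This file adds the WINDOWED S_H form, i.e. the degree-one cut of this seat's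
`abc_of_SH_v11M_window` (C-R23 (c) #4): per admissible RATIONAL datum, S_H (pinned reading at abc-iut-s2-p8's summand-route M-level setting of
the datum's OWN ideles) is demanded ONLY OFF abc-iut-w5-d166's explicit M-depth locus (the `∃ u i x₀` clause of `not_hSH_v10M_of_exists_deep`,
p444095, VERBATIM) and the NUMBER-level Corollary `T.Cor312Of` ONLY ON it; the CONE binder is absent because at `d_mod = 1` the hull-volume
estimate is a theorem (abc-iut-S2 `ThetaPartIIDisplay.hullVolumeAtDatum_BIII_of_degree_le_one`, inside `vojtaIneq_two_degOne_of_cor312`), and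
the Θ-side binder is absent because hΘ is a theorem at the M setting (abc-iut-s2-p8 p440655).

* **`vojta_degOne_of_SH_v11M_window`** — DATA = v10M/v11M's VERBATIM; HYPOTHESES = [S_H, WINDOW, d = 1] `hSHw` · [NUM, DEEP, d = 1] `hNum`
  (both = the binders of `abc_of_SH_v11M_window` with ONE extra guard `P.degree ≤ 1`, i.e. WEAKER); CONCLUSION = `VojtaIneq D.toSet 1 ε`
  for every `ε > 0` and every `D : CBData` with `D.SupportContains {2}` (Vojta(1+ε) for the degree-1 points = abc for the triples balanced
  at 2 and ∞). Proof: per admissible rational datum `by_cases` on the M-depth locus → `hNum` / abc-iut-s2-p12's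
  `GenuineMShrink2.cor312Of_of_SH` (p442072) at `hSHw`; then abc-iut-S2's `ThetaPartIIDisplay.vojtaIneq_two_degOne_of_cor312`.

What the windowed cut does NOT survive relative to `Summit.ABC` is exactly [GenEll] Thm. 2.1 (ii)⇒(i) (passage to degree > 1), as for
p443731. HONEST FRAMING: locates / conditionally verifies; nothing here asserts that abc (balanced or not) is proved or refuted, or that
[IUTchIII] Cor. 3.12 holds or fails at any datum, or takes a side on any author; `hSHw` is not known to be satisfiable at every rational
admissible datum off the locus; `hNum` is an assumption label for the disputed inequality, never asserted; «Vojta at degree 1 follows from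
these hypotheses AS TYPED», nothing more; refuted-as-typed ≠ refuted-in-print; typed ≠ proved; instantiated ≠ endorsed.
[claim: Mochizuki2012, status: disputed] [cite: Mochizuki2012, IUTchIII Cor. 3.12 p. 173–174, Step (xi-f) p. 184; IUTchIV Thm. 1.10 p. 22–31,
Cor. 2.2 (ii)–(iii) p. 43–47, Cor. 2.3 p. 54–55] [cite: MochizukiGenEll2010, Thm. 2.1 p. 12]
-/

noncomputable section

open Set Function NumberField IsDedekindDomain

namespace Summit.ABC.IUTFork.Conditional

open Thm311 Thm311.Real Cor312 Cor312Vol Cor312Prov Literature.IUT.LogThetaLattice Literature.IUT.LogVolume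
  Literature.IUT.HodgeTheaters Literature.IUT.LogVolume.ThetaData Literature.NumberTheory.NumberFields
open Literature.NumberTheory.DiophantineGeometry.GenEll Summit.ABC.ABC.Theorems

/-- **`vojta_degOne_of_SH_v11M_window`** (branch C, M line, DEGREE-ONE CUT of the window certificate; explicit 2 = S_H(window) 1 · NUM(deep) 1 ·
CONE 0 · READ 0). Vojta's height inequality with the printed `1+ε` for the degree-`1` points of every compactly bounded `K_V` whose support
contains `2`, from the v11M-window data and hypotheses restricted to admissible RATIONAL points (`P ∈ U_P`, `P.degree ≤ 1`, `l` prime `≥ 5`,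
`AdmitsCore`, (P2), (P5), (P6)): S_H ONLY OFF the explicit M-depth locus, the number-level Corollary ONLY ON it. «Vojta at degree 1 follows from
these hypotheses as typed, at these data» — no side taken on [IUTchIII] Cor. 3.12; typed ≠ proved; instantiated ≠ endorsed.
[claim: Mochizuki2012, status: disputed] -/
theorem vojta_degOne_of_SH_v11M_window
    -- DATA, per datum: the context binders of the summand-route M-level sharp setting (logs FIXED: analytic), the column data, qK (ρ is PINNED to the q-region)
    (M : ∀ (P : NFPoint) (l : ℕ) (T : Cor22.ThetaVolumeDatumAt P l), Type) [∀ P l T, Field (M P l T)] [∀ P l T, NumberField (M P l T)]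
    (archPk : ∀ (P : NFPoint) (l : ℕ) (T : Cor22.ThetaVolumeDatumAt P l), letI := T.instFieldF; letI := T.instNumberFieldF; letI := T.instAlgebraF; letI := T.instFieldK;
        letI := T.instNumberFieldK; letI := T.instAlgebraK; letI := T.instFieldFbar; letI := T.instAlgebraFbar;
        letI := T.instAlgebraKFbar; letI := T.instIsElliptic;
      ∀ (j : (thetaIndexOfInitial T.D).Label) (vQ : (thetaIndexOfInitial T.D).VQ), Set ((logShellsOfInitialDH T.D (analyticLogvVal T.K)).Packet j vQ))
    (archSub : ∀ (P : NFPoint) (l : ℕ) (T : Cor22.ThetaVolumeDatumAt P l), letI := T.instFieldF; letI := T.instNumberFieldF; letI := T.instAlgebraF; letI := T.instFieldK;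
        letI := T.instNumberFieldK; letI := T.instAlgebraK; letI := T.instFieldFbar; letI := T.instAlgebraFbar;
        letI := T.instAlgebraKFbar; letI := T.instIsElliptic;
      ∀ (j : (thetaIndexOfInitial T.D).Label) (v : (thetaIndexOfInitial T.D).V), Set ((logShellsOfInitialDH T.D (analyticLogvVal T.K)).Packet j ((thetaIndexOfInitial T.D).over v)))
    (Ψ : ∀ (P : NFPoint) (l : ℕ) (T : Cor22.ThetaVolumeDatumAt P l), letI := T.instFieldF; letI := T.instNumberFieldF; letI := T.instAlgebraF; letI := T.instFieldK;
        letI := T.instNumberFieldK; letI := T.instAlgebraK; letI := T.instFieldFbar; letI := T.instAlgebraFbar;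
        letI := T.instAlgebraKFbar; letI := T.instIsElliptic;
      ℤ → ∀ v : (thetaIndexOfInitial T.D).V, v ∈ (thetaIndexOfInitial T.D).Vbad → Set ((logShellsOfInitialDH T.D (analyticLogvVal T.K)).StarPacket v))
    (act : ∀ (P : NFPoint) (l : ℕ) (T : Cor22.ThetaVolumeDatumAt P l), letI := T.instFieldF; letI := T.instNumberFieldF; letI := T.instAlgebraF; letI := T.instFieldK;
        letI := T.instNumberFieldK; letI := T.instAlgebraK; letI := T.instFieldFbar; letI := T.instAlgebraFbar;
        letI := T.instAlgebraKFbar; letI := T.instIsElliptic;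
      ℤ → ∀ v : (thetaIndexOfInitial T.D).V, v ∈ (thetaIndexOfInitial T.D).Vbad → (logShellsOfInitialDH T.D (analyticLogvVal T.K)).StarPacket v → Module.End ℚ ((logShellsOfInitialDH T.D (analyticLogvVal T.K)).StarPacket v))
    (Mmod : ∀ (P : NFPoint) (l : ℕ) (T : Cor22.ThetaVolumeDatumAt P l), letI := T.instFieldF; letI := T.instNumberFieldF; letI := T.instAlgebraF; letI := T.instFieldK;
        letI := T.instNumberFieldK; letI := T.instAlgebraK; letI := T.instFieldFbar; letI := T.instAlgebraFbar;
        letI := T.instAlgebraKFbar; letI := T.instIsElliptic;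
      ℤ → ∀ j : (thetaIndexOfInitial T.D).LabelStar, Set ((logShellsOfInitialDH T.D (analyticLogvVal T.K)).GlobalPacket j.1))
    (region : ∀ (P : NFPoint) (l : ℕ) (T : Cor22.ThetaVolumeDatumAt P l), letI := T.instFieldF; letI := T.instNumberFieldF; letI := T.instAlgebraF; letI := T.instFieldK;
        letI := T.instNumberFieldK; letI := T.instAlgebraK; letI := T.instFieldFbar; letI := T.instAlgebraFbar;
        letI := T.instAlgebraKFbar; letI := T.instIsElliptic;
      ℤ → ∀ j : (thetaIndexOfInitial T.D).LabelStar, FinDivisor (M P l T) → ∀ vQ : (thetaIndexOfInitial T.D).VQ, Set ((logShellsOfInitialDH T.D (analyticLogvVal T.K)).Packet j.1 vQ))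
    (frobAdm : ∀ (P : NFPoint) (l : ℕ) (T : Cor22.ThetaVolumeDatumAt P l), letI := T.instFieldF; letI := T.instNumberFieldF; letI := T.instAlgebraF; letI := T.instFieldK;
        letI := T.instNumberFieldK; letI := T.instAlgebraK; letI := T.instFieldFbar; letI := T.instAlgebraFbar;
        letI := T.instAlgebraKFbar; letI := T.instIsElliptic;
      ℤ → ℤ → ∀ (j : (thetaIndexOfInitial T.D).Label) (vQ : (thetaIndexOfInitial T.D).VQ), Set ((logShellsOfInitialDH T.D (analyticLogvVal T.K)).Packet j vQ) → Prop)
    (frobLogvol : ∀ (P : NFPoint) (l : ℕ) (T : Cor22.ThetaVolumeDatumAt P l), letI := T.instFieldF; letI := T.instNumberFieldF; letI := T.instAlgebraF; letI := T.instFieldK;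
        letI := T.instNumberFieldK; letI := T.instAlgebraK; letI := T.instFieldFbar; letI := T.instAlgebraFbar;
        letI := T.instAlgebraKFbar; letI := T.instIsElliptic;
      ℤ → ℤ → ∀ (j : (thetaIndexOfInitial T.D).Label) (vQ : (thetaIndexOfInitial T.D).VQ), Set ((logShellsOfInitialDH T.D (analyticLogvVal T.K)).Packet j vQ) → ℝ)
    (frobΨ : ∀ (P : NFPoint) (l : ℕ) (T : Cor22.ThetaVolumeDatumAt P l), letI := T.instFieldF; letI := T.instNumberFieldF; letI := T.instAlgebraF; letI := T.instFieldK;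
        letI := T.instNumberFieldK; letI := T.instAlgebraK; letI := T.instFieldFbar; letI := T.instAlgebraFbar;
        letI := T.instAlgebraKFbar; letI := T.instIsElliptic;
      ℤ → ℤ → ∀ v : (thetaIndexOfInitial T.D).V, v ∈ (thetaIndexOfInitial T.D).Vbad → Set ((logShellsOfInitialDH T.D (analyticLogvVal T.K)).StarPacket v))
    (frobMmod : ∀ (P : NFPoint) (l : ℕ) (T : Cor22.ThetaVolumeDatumAt P l), letI := T.instFieldF; letI := T.instNumberFieldF; letI := T.instAlgebraF; letI := T.instFieldK;
        letI := T.instNumberFieldK; letI := T.instAlgebraK; letI := T.instFieldFbar; letI := T.instAlgebraFbar;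
        letI := T.instAlgebraKFbar; letI := T.instIsElliptic;
      ℤ → ℤ → ∀ j : (thetaIndexOfInitial T.D).LabelStar, Set ((logShellsOfInitialDH T.D (analyticLogvVal T.K)).GlobalPacket j.1))
    (unitImage : ∀ (P : NFPoint) (l : ℕ) (T : Cor22.ThetaVolumeDatumAt P l), letI := T.instFieldF; letI := T.instNumberFieldF; letI := T.instAlgebraF; letI := T.instFieldK;
        letI := T.instNumberFieldK; letI := T.instAlgebraK; letI := T.instFieldFbar; letI := T.instAlgebraFbar;
        letI := T.instAlgebraKFbar; letI := T.instIsElliptic;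
      ℤ → ℤ → ℕ → ∀ (j : (thetaIndexOfInitial T.D).Label) (vQ : (thetaIndexOfInitial T.D).VQ), Set ((logShellsOfInitialDH T.D (analyticLogvVal T.K)).Packet j vQ))
    (ballImage : ∀ (P : NFPoint) (l : ℕ) (T : Cor22.ThetaVolumeDatumAt P l), letI := T.instFieldF; letI := T.instNumberFieldF; letI := T.instAlgebraF; letI := T.instFieldK;
        letI := T.instNumberFieldK; letI := T.instAlgebraK; letI := T.instFieldFbar; letI := T.instAlgebraFbar;
        letI := T.instAlgebraKFbar; letI := T.instIsElliptic;
      ℤ → ℤ → ∀ (j : (thetaIndexOfInitial T.D).Label) (vQ : (thetaIndexOfInitial T.D).VQ), Set ((logShellsOfInitialDH T.D (analyticLogvVal T.K)).Packet j vQ))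
    (thetaDiv : ∀ (P : NFPoint) (l : ℕ) (T : Cor22.ThetaVolumeDatumAt P l), letI := T.instFieldF; letI := T.instNumberFieldF; letI := T.instAlgebraF; letI := T.instFieldK;
        letI := T.instNumberFieldK; letI := T.instAlgebraK; letI := T.instFieldFbar; letI := T.instAlgebraFbar;
        letI := T.instAlgebraKFbar; letI := T.instIsElliptic;
      ℤ → ℤ → LgpDivisor (M P l T) (thetaIndexOfInitial T.D).lstar)
    (n : ∀ (P : NFPoint) (l : ℕ) (T : Cor22.ThetaVolumeDatumAt P l), ℤ)
    {HT : ∀ (P : NFPoint) (l : ℕ) (T : Cor22.ThetaVolumeDatumAt P l), Type} {LogLink : ∀ (P : NFPoint) (l : ℕ) (T : Cor22.ThetaVolumeDatumAt P l), HT P l T → HT P l T → Type}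
    {IsFull : ∀ (P : NFPoint) (l : ℕ) (T : Cor22.ThetaVolumeDatumAt P l), ∀ {s t : HT P l T}, LogLink P l T s t → Prop}
    (lat : ∀ (P : NFPoint) (l : ℕ) (T : Cor22.ThetaVolumeDatumAt P l), LGPGaussianLogThetaLattice (LogLink P l T) (IsFull P l T))
    {Frd : ∀ (P : NFPoint) (l : ℕ) (T : Cor22.ThetaVolumeDatumAt P l), Type} {IsoF : ∀ (P : NFPoint) (l : ℕ) (T : Cor22.ThetaVolumeDatumAt P l), Frd P l T → Frd P l T → Type} {Ob : ∀ (P : NFPoint) (l : ℕ) (T : Cor22.ThetaVolumeDatumAt P l), Frd P l T → Type}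
    {realify : ∀ (P : NFPoint) (l : ℕ) (T : Cor22.ThetaVolumeDatumAt P l), Frd P l T → Frd P l T} {Strip : ∀ (P : NFPoint) (l : ℕ) (T : Cor22.ThetaVolumeDatumAt P l), Type} {IsoS : ∀ (P : NFPoint) (l : ℕ) (T : Cor22.ThetaVolumeDatumAt P l), Strip P l T → Strip P l T → Type}
    {Mv : ∀ (P : NFPoint) (l : ℕ) (T : Cor22.ThetaVolumeDatumAt P l), letI := T.instFieldF; letI := T.instNumberFieldF; letI := T.instAlgebraF; letI := T.instFieldK;
        letI := T.instNumberFieldK; letI := T.instAlgebraK; letI := T.instFieldFbar; letI := T.instAlgebraFbar;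
        letI := T.instAlgebraKFbar; letI := T.instIsElliptic;
      ∀ v : (thetaIndexOfInitial T.D).V, v ∈ (thetaIndexOfInitial T.D).Vbad → Type}
    [∀ P l T v h, Monoid (Mv P l T v h)]
    (sig : ∀ (P : NFPoint) (l : ℕ) (T : Cor22.ThetaVolumeDatumAt P l), letI := T.instFieldF; letI := T.instNumberFieldF; letI := T.instAlgebraF; letI := T.instFieldK;
        letI := T.instNumberFieldK; letI := T.instAlgebraK; letI := T.instFieldFbar; letI := T.instAlgebraFbar;
        letI := T.instAlgebraKFbar; letI := T.instIsElliptic;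
      GlobalLGPFrobenioidSignature (thetaIndexOfInitial T.D).lstar (thetaIndexOfInitial T.D).V (· ∈ (thetaIndexOfInitial T.D).Vbad) (Frd P l T) (IsoF P l T) (Ob P l T) (realify P l T)
        (Strip P l T) (IsoS P l T) (Mv P l T))
    (split : ∀ (P : NFPoint) (l : ℕ) (T : Cor22.ThetaVolumeDatumAt P l), SplittingMonoids (Mv P l T))
    {ObΔ : ∀ (P : NFPoint) (l : ℕ) (T : Cor22.ThetaVolumeDatumAt P l), Type}
    {N : ∀ (P : NFPoint) (l : ℕ) (T : Cor22.ThetaVolumeDatumAt P l), letI := T.instFieldF; letI := T.instNumberFieldF; letI := T.instAlgebraF; letI := T.instFieldK;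
        letI := T.instNumberFieldK; letI := T.instAlgebraK; letI := T.instFieldFbar; letI := T.instAlgebraFbar;
        letI := T.instAlgebraKFbar; letI := T.instIsElliptic;
      ∀ v : (thetaIndexOfInitial T.D).V, v ∈ (thetaIndexOfInitial T.D).Vbad → Type}
    [∀ P l T v h, Monoid (N P l T v h)] (qData : ∀ (P : NFPoint) (l : ℕ) (T : Cor22.ThetaVolumeDatumAt P l), QPilotData (ObΔ P l T) (N P l T))
    (qK : ∀ (P : NFPoint) (l : ℕ) (T : Cor22.ThetaVolumeDatumAt P l), letI := T.instFieldF; letI := T.instNumberFieldF; letI := T.instAlgebraF; letI := T.instFieldK;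
        letI := T.instNumberFieldK; letI := T.instAlgebraK; letI := T.instFieldFbar; letI := T.instAlgebraFbar;
        letI := T.instAlgebraKFbar; letI := T.instIsElliptic;
      ∀ v : (thetaIndexOfInitial T.D).V, v ∈ (thetaIndexOfInitial T.D).Vbad → Set ((logShellsOfInitialDH T.D (analyticLogvVal T.K)).StarPacket v))
    -- [S_H, WINDOW] v10M's hull-level clause (pinned reading, own ideles), ONLY at admissible RATIONAL data OFF the explicit M-depth locus
    (hSHw : ∀ (P : NFPoint), P ∈ UP → P.degree ≤ 1 → ∀ (l : ℕ), l.Prime → 5 ≤ l →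
      Cor22.AdmitsCore P → Cor22.CondP2 P l → Cor22.CondP5 P l → Cor22.CondP6 P l →
      ∀ (T : Cor22.ThetaVolumeDatumAt P l), letI := T.instFieldF; letI := T.instNumberFieldF; letI := T.instAlgebraF; letI := T.instFieldK;
        letI := T.instNumberFieldK; letI := T.instAlgebraK; letI := T.instFieldFbar; letI := T.instAlgebraFbar;
        letI := T.instAlgebraKFbar; letI := T.instIsElliptic;
      (¬ ∃ (u : FinitePlace ℚ) (i : Fin (thetaIndexOfInitial T.D).lstar) (x₀ : (thetaIndexOfInitial T.D).Fibre (Val.non u)),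
        ((ratChar u : ℕ) : ℝ) ^ ((((i : ℕ) : ℝ) + 2) *
        (differentOrd (ratChar u) (kOfM T.D (ratChar u) u (natCast_ratChar_mem u) x₀)
        + logRadiusA (ratChar u) (absRamificationIdx (ratChar u) (kOfM T.D (ratChar u) u (natCast_ratChar_mem u) x₀))
        + logRadiusB (ratChar u) (absRamificationIdx (ratChar u) (kOfM T.D (ratChar u) u (natCast_ratChar_mem u) x₀))) + 1) *
        ‖tqM T.D (ratChar u) u (natCast_ratChar_mem u) (ideleDataOf T.D T.isVolumeInputOf) x₀‖ ^ (((i : ℕ) + 1) ^ 2 - 1) < 1) →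
      Cor312Vol.PilotKummerCompatHull
        (LatticeSituation.ofShells (logShellsOfInitialDH T.D (analyticLogvVal T.K)) (M P l T) (archPk P l T) (archSub P l T)
          (summandPiecesPrM T.D (logvAnalyticVal_analyticLogvVal (K := T.K))).Adm
          (summandPiecesPrM T.D (logvAnalyticVal_analyticLogvVal (K := T.K))).logvol (Ψ P l T) (act P l T) (Mmod P l T)
          (region P l T) (frobAdm P l T) (frobLogvol P l T) (frobΨ P l T) (frobMmod P l T) (unitImage P l T) (ballImage P l T)
          (thetaDiv P l T))
        (settingPrVolSharpM T.D (logvAnalyticVal_analyticLogvVal (K := T.K)) (tOfIdeleData T.D (ideleDataOf T.D T.isVolumeInputOf))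
          (fun u x => tqM T.D (ratChar u) u (natCast_ratChar_mem u) (ideleDataOf T.D T.isVolumeInputOf) x)
          (M P l T) (archPk P l T) (archSub P l T) (Ψ P l T) (act P l T)
          (Mmod P l T) (region P l T) (n P l T) (lat P l T) (sig P l T) (split P l T) (qData P l T)
          (fun u x => tqM_ne_zero T.D (ratChar u) u (natCast_ratChar_mem u) (ideleDataOf T.D T.isVolumeInputOf) x)
          (GenuineM.finite_ratPlaces_under_S T.D).toFinset
          (fun u x hu => norm_tqM_eq_one_of_not_mem T.D (ratChar u) u (natCast_ratChar_mem u) (ideleDataOf T.D T.isVolumeInputOf) x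
            fun hx => hu ((Set.Finite.mem_toFinset _).mpr ⟨x, hx⟩))) 
        (fun _ => Cor312.Setting.qRegion
        (settingPrVolSharpM T.D (logvAnalyticVal_analyticLogvVal (K := T.K)) (tOfIdeleData T.D (ideleDataOf T.D T.isVolumeInputOf))
          (fun u x => tqM T.D (ratChar u) u (natCast_ratChar_mem u) (ideleDataOf T.D T.isVolumeInputOf) x)
          (M P l T) (archPk P l T) (archSub P l T) (Ψ P l T) (act P l T)
          (Mmod P l T) (region P l T) (n P l T) (lat P l T) (sig P l T) (split P l T) (qData P l T)
          (fun u x => tqM_ne_zero T.D (ratChar u) u (natCast_ratChar_mem u) (ideleDataOf T.D T.isVolumeInputOf) x)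
          (GenuineM.finite_ratPlaces_under_S T.D).toFinset
          (fun u x hu => norm_tqM_eq_one_of_not_mem T.D (ratChar u) u (natCast_ratChar_mem u) (ideleDataOf T.D T.isVolumeInputOf) x
            fun hx => hu ((Set.Finite.mem_toFinset _).mpr ⟨x, hx⟩)))) (qK P l T))
    -- [NUM, DEEP] the NUMBER-level Corollary 3.12 of the datum, ONLY at admissible RATIONAL data ON the M-depth locus (where v10M's `hSH` is refuted, p444095)
    (hNum : ∀ (P : NFPoint), P ∈ UP → P.degree ≤ 1 → ∀ (l : ℕ), l.Prime → 5 ≤ l →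
      Cor22.AdmitsCore P → Cor22.CondP2 P l → Cor22.CondP5 P l → Cor22.CondP6 P l →
      ∀ (T : Cor22.ThetaVolumeDatumAt P l), letI := T.instFieldF; letI := T.instNumberFieldF; letI := T.instAlgebraF; letI := T.instFieldK;
        letI := T.instNumberFieldK; letI := T.instAlgebraK; letI := T.instFieldFbar; letI := T.instAlgebraFbar;
        letI := T.instAlgebraKFbar; letI := T.instIsElliptic;
      (∃ (u : FinitePlace ℚ) (i : Fin (thetaIndexOfInitial T.D).lstar) (x₀ : (thetaIndexOfInitial T.D).Fibre (Val.non u)),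
        ((ratChar u : ℕ) : ℝ) ^ ((((i : ℕ) : ℝ) + 2) *
        (differentOrd (ratChar u) (kOfM T.D (ratChar u) u (natCast_ratChar_mem u) x₀)
        + logRadiusA (ratChar u) (absRamificationIdx (ratChar u) (kOfM T.D (ratChar u) u (natCast_ratChar_mem u) x₀))
        + logRadiusB (ratChar u) (absRamificationIdx (ratChar u) (kOfM T.D (ratChar u) u (natCast_ratChar_mem u) x₀))) + 1) *
        ‖tqM T.D (ratChar u) u (natCast_ratChar_mem u) (ideleDataOf T.D T.isVolumeInputOf) x₀‖ ^ (((i : ℕ) + 1) ^ 2 - 1) < 1) → T.Cor312Of)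
    -- [CONE] NONE (`d_mod = 1`) · [READ]/[ORBIT]/[PIN]/[PROV]/[BRIDGE]/[SIDE]/[FACT] none (theorems / `rfl` at the M setting)
    {ε : ℝ} (hε : 0 < ε) (D : CBData) (hD : D.SupportContains {2}) : VojtaIneq D.toSet 1 ε := by
  -- per ADMISSIBLE genuine Θ-volume datum of a RATIONAL point: ON the M-depth locus the number-level Corollary is `hNum`; OFF it, [IUTchIII]
  -- Cor 3.12 on the hull-level line at the summand-route M-setting from S_H (abc-iut-s2-p12 p442072); then abc-iut-S2's degree-one display
  refine ThetaPartIIDisplay.vojtaIneq_two_degOne_of_cor312 (fun P hP hdeg l hl h5 hc h2 h5' h6 T => ?_) hε D hD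
  letI := T.instFieldF; letI := T.instNumberFieldF; letI := T.instAlgebraF; letI := T.instFieldK
  letI := T.instNumberFieldK; letI := T.instAlgebraK; letI := T.instFieldFbar; letI := T.instAlgebraFbar
  letI := T.instAlgebraKFbar; letI := T.instIsElliptic
  by_cases hdeep : ∃ (u : FinitePlace ℚ) (i : Fin (thetaIndexOfInitial T.D).lstar) (x₀ : (thetaIndexOfInitial T.D).Fibre (Val.non u)),
        ((ratChar u : ℕ) : ℝ) ^ ((((i : ℕ) : ℝ) + 2) *
        (differentOrd (ratChar u) (kOfM T.D (ratChar u) u (natCast_ratChar_mem u) x₀)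
        + logRadiusA (ratChar u) (absRamificationIdx (ratChar u) (kOfM T.D (ratChar u) u (natCast_ratChar_mem u) x₀))
        + logRadiusB (ratChar u) (absRamificationIdx (ratChar u) (kOfM T.D (ratChar u) u (natCast_ratChar_mem u) x₀))) + 1) *
        ‖tqM T.D (ratChar u) u (natCast_ratChar_mem u) (ideleDataOf T.D T.isVolumeInputOf) x₀‖ ^ (((i : ℕ) + 1) ^ 2 - 1) < 1
  · exact hNum P hP hdeg l hl h5 hc h2 h5' h6 T hdeep
  · exact GenuineMShrink2.cor312Of_of_SH T.D (M P l T) (archPk P l T) (archSub P l T) (Ψ P l T) (act P l T) (Mmod P l T)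
      (region P l T) (frobAdm P l T) (frobLogvol P l T) (frobΨ P l T) (frobMmod P l T) (unitImage P l T) (ballImage P l T)
      (thetaDiv P l T) (n P l T) (lat P l T) (sig P l T) (split P l T) (qData P l T) (qK P l T) T.isVolumeInputOf
      (hSHw P hP hdeg l hl h5 hc h2 h5' h6 T hdeep)

end Summit.ABC.IUTFork.Conditional

end
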